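import Mathlib.Data.Real.Basic
import Mathlib.Algebra.Order.Field.Basic
import Mathlib.Algebra.BigOperators.Ring.Finset
import Mathlib.Algebra.Order.BigOperators.Group.Finset
import Mathlib.Tactic.Linarith
import Mathlib.Tactic.Positivity
import Mathlib.Tactic.Ring
import Mathlib.Tactic.FieldSimp
import HarnessLib

/-!
# `NoHeavyLowerTail` (stmt-CriticalPhenomena-4575) — the AM–GM / hypothesis-only induction step for the variance inequalities (V), (Q0), (V-F)

Support file (prover prim-ineq-gen-8 gen 48; `--supports stmt-CriticalPhenomena-4575`; memo
run/shared/lean/prim/prim-ineq-gen-8/FINDING-gen48-AMGM.md).  Pure real algebra: no definitions, no named facts, no sorries.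

SETTING (memo §1).  Bond percolation on a finite graph, apex cluster `K`, loads `ℓ ≥ 0`, `L = ℓ(K)`, `R = Σ_{C ≠ K} ℓ(C)²`,
`V = Var L`, `EL = E L`, `|C| = −Cov(L,R) ≥ 0`, `F = Σ_z ℓ_z p_z(1−p_z)`.  Targets: (V) `V² ≤ 2·EL·|C|`, (Q0) `V² ≤ 2·EL·C⁺`
(`C⁺ = 2|C| − κ₃(L)/3`), (V-F) `V² ≤ 2·F·|C|`; with (P) (gen 40, kernel) (V) ⟹ (Q0) ⟹ `E3(θ) ≤ 0`.
Conditioning on ONE boundary edge `e` of the apex cluster (weight `p`, `q = 1 − p`; piece moments `a = E D`, `b = E D²`, `c = Σ ℓ φ²`)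
gives the EXACT recursions (law of total variance / covariance, `R¹ = R⁰ − D²`; memo §1):
`EL = p E¹ + q E⁰`, `V = p q a² + p V¹ + q V⁰`, `|C| = p q a b + p |C¹| + q |C⁰|`, `F = p q c + p F¹ + q F⁰` (and `C⁺` with `b ↦ b⁺`).
If both conditioned instances (one random edge fewer) satisfy the target — used only as `2 E¹|C¹| ≥ (V¹)²`, `2 E⁰|C⁰| ≥ (V⁰)²` — then the
target for the instance follows from the single LOCAL inequality (discriminant form)
  (L-V*)  `V² ≤ EL · (p (V¹)²/E¹ + q (V⁰)²/E⁰ + 2 p q a b)`,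
equivalently (for `E¹, E⁰ > 0`, `mhat_form_iff` below) `2a²V ≤ 2ab·EL + p q a⁴ + (V¹E⁰ − V⁰E¹)²/(E¹E⁰)`, i.e.
`V ≤ (b/a)·EL + ½ p q a² + Δ_e/(2a²)` — "the variance is at most the size-biased piece load of `e` times the mean, up to two explicit
nonnegative corrections".  Hence: (L-V*) at every state for SOME boundary edge ⟹ (V) on every finite graph, by induction on the number of
random edges (memo §2; 0 failures in > 3·10⁴ enumerated states and under adversarial search, always already for the largest-`b/a` edge, memo §3).
THIS FILE [this work]: `amgm_step` (the assembly), `mhat_form` (discriminant form ⟸ size-biased form, via the two-point Cauchy–Schwarz identity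
`cs_two_point`), `good_piece_quadratic` (memo Lemma A: `a³ ≤ 2bc` ⟹ the (V-F) local quadratic is nonnegative), and the forest case
`forest_local` + `rest_le_of_mhat_le` (memo §2(c): (L-V*) holds for the largest-`b/a` boundary edge on every forest).
-/

noncomputable section

namespace Summit.CriticalPhenomena.PercolationContinuityZ3.Theorems

namespace APL

open Finset
open scoped BigOperators

/-! ### The assembly: children's inequality + local discriminant condition ⟹ parent's inequality -/

/-- **AM–GM / hypothesis-only step.**  `p ∈ [0,1]`; the children satisfy the target in the form `(Vⁱ)² ≤ Eⁱ·Wⁱ` with `Wⁱ ≤ 2 Cⁱ`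
(`Wⁱ = (Vⁱ)²/Eⁱ`, or `0` for a deterministic child); the parent's `EL, C` obey the one-edge recursions (`EL ≥ 0`); and the local
inequality (L-V*) `V² ≤ EL (p W¹ + q W⁰ + 2 p q a b)` holds.  Then `V² ≤ 2 EL C`.  (For (Q0) read `b, C` as `b⁺, C⁺`; for (V-F)
read `EL` as `F` — the recursion for `F` is not used here.) [this work] -/
theorem amgm_step (p a b W1 W0 C1 C0 V EL C : ℝ) (hp0 : 0 ≤ p) (hp1 : p ≤ 1) (hEL : 0 ≤ EL)
    (hW1 : W1 ≤ 2 * C1) (hW0 : W0 ≤ 2 * C0)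
    (hC : C = p * (1 - p) * a * b + p * C1 + (1 - p) * C0)
    (hloc : V ^ 2 ≤ EL * (p * W1 + (1 - p) * W0 + 2 * (p * (1 - p)) * a * b)) :
    V ^ 2 ≤ 2 * EL * C := by
  have hq : 0 ≤ 1 - p := by linarith
  have h : EL * (p * W1 + (1 - p) * W0 + 2 * (p * (1 - p)) * a * b) ≤ 2 * EL * C := by
    rw [hC]
    have : p * W1 + (1 - p) * W0 + 2 * (p * (1 - p)) * a * b
        ≤ 2 * (p * (1 - p) * a * b + p * C1 + (1 - p) * C0) := by
      nlinarith [mul_le_mul_of_nonneg_left hW1 hp0, mul_le_mul_of_nonneg_left hW0 hq]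
    calc EL * (p * W1 + (1 - p) * W0 + 2 * (p * (1 - p)) * a * b)
        ≤ EL * (2 * (p * (1 - p) * a * b + p * C1 + (1 - p) * C0)) := mul_le_mul_of_nonneg_left this hEL
      _ = 2 * EL * (p * (1 - p) * a * b + p * C1 + (1 - p) * C0) := by ring
  exact hloc.trans h

/-- **Two-point Cauchy–Schwarz identity** (denominator-free): `(pE¹ + qE⁰)(pE⁰(V¹)² + qE¹(V⁰)²) = E¹E⁰ (pV¹ + qV⁰)² + pq (V¹E⁰ − V⁰E¹)²`.
[standard; this work records it] -/
theorem cs_two_point (p E1 E0 V1 V0 : ℝ) :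
    (p * E1 + (1 - p) * E0) * (p * E0 * V1 ^ 2 + (1 - p) * E1 * V0 ^ 2)
      = E1 * E0 * (p * V1 + (1 - p) * V0) ^ 2 + p * (1 - p) * (V1 * E0 - V0 * E1) ^ 2 := by
  ring

/-- **Size-biased form ⟹ discriminant form.**  With `V = pq a² + pV¹ + qV⁰`, `EL = pE¹ + qE⁰`, `E¹, E⁰ > 0` and `Wⁱ = (Vⁱ)²/Eⁱ`:
if `E¹E⁰·2a²V ≤ E¹E⁰·(2ab·EL + pq a⁴) + (V¹E⁰ − V⁰E¹)²` (i.e. `V ≤ (b/a) EL + ½pq a² + Δ_e/(2a²)`), then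
`V² ≤ EL (pW¹ + qW⁰ + 2pq a b)`. [this work] -/
theorem mhat_form (p a b E1 E0 V1 V0 V EL : ℝ) (hp0 : 0 ≤ p) (hp1 : p ≤ 1) (hE1 : 0 < E1) (hE0 : 0 < E0)
    (hV : V = p * (1 - p) * a ^ 2 + p * V1 + (1 - p) * V0) (hEL : EL = p * E1 + (1 - p) * E0)
    (hloc : E1 * E0 * (2 * a ^ 2 * V) ≤ E1 * E0 * (2 * a * b * EL + p * (1 - p) * a ^ 4) + (V1 * E0 - V0 * E1) ^ 2) :
    V ^ 2 ≤ EL * (p * (V1 ^ 2 / E1) + (1 - p) * (V0 ^ 2 / E0) + 2 * (p * (1 - p)) * a * b) := by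
  have hq : 0 ≤ 1 - p := by linarith
  have hpos : 0 < E1 * E0 := mul_pos hE1 hE0
  -- multiply the goal by E1 E0 > 0
  have hfrac : E1 * E0 * (EL * (p * (V1 ^ 2 / E1) + (1 - p) * (V0 ^ 2 / E0) + 2 * (p * (1 - p)) * a * b))
      = EL * (p * E0 * V1 ^ 2 + (1 - p) * E1 * V0 ^ 2) + E1 * E0 * EL * (2 * (p * (1 - p)) * a * b) := by
    field_simp
  have hcs := cs_two_point p E1 E0 V1 V0
  rw [← hEL] at hcs
  have hb : 0 ≤ E1 * E0 * (2 * a * b * EL + p * (1 - p) * a ^ 4) + (V1 * E0 - V0 * E1) ^ 2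
      - E1 * E0 * (2 * a ^ 2 * V) := by linarith [hloc]
  have hid : E1 * E0 * (p * V1 + (1 - p) * V0) ^ 2 + p * (1 - p) * (V1 * E0 - V0 * E1) ^ 2
        + E1 * E0 * EL * (2 * (p * (1 - p)) * a * b) - E1 * E0 * V ^ 2
      = p * (1 - p) * (E1 * E0 * (2 * a * b * EL + p * (1 - p) * a ^ 4) + (V1 * E0 - V0 * E1) ^ 2
        - E1 * E0 * (2 * a ^ 2 * V)) := by
    rw [hV]; ring
  have key : E1 * E0 * V ^ 2
      ≤ E1 * E0 * (EL * (p * (V1 ^ 2 / E1) + (1 - p) * (V0 ^ 2 / E0) + 2 * (p * (1 - p)) * a * b)) := by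
    rw [hfrac, hcs]
    nlinarith [hid, mul_nonneg (mul_nonneg hp0 hq) hb]
  exact le_of_mul_le_mul_left key hpos

/-! ### Lemma A: good pieces -/

/-- **Good-piece quadratic** (memo Lemma A).  If `a, c ≥ 0` and `a³ ≤ 2 b c`, then for all reals `V̄, F̄`:
`c V̄² − 2 a² V̄ F̄ + 2 a b F̄² ≥ 0` (discriminant `4a(a³ − 2bc)F̄² ≤ 0`).  This is the (V-F) local quadratic; with the Cauchy–Schwarz
excess and `pq·a(2bc − a³) ≥ 0` it gives the (V-F) step at every boundary edge whose piece satisfies `a³ ≤ 2bc`. [this work] -/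
theorem good_piece_quadratic (a b c Fb Vb : ℝ) (ha : 0 ≤ a) (hc : 0 ≤ c)
    (hgood : a ^ 3 ≤ 2 * b * c) :
    0 ≤ c * Vb ^ 2 - 2 * a ^ 2 * Vb * Fb + 2 * a * b * Fb ^ 2 := by
  have h4 : a ^ 4 ≤ 2 * a * b * c := by nlinarith
  rcases eq_or_lt_of_le hc with hc0 | hcpos
  · -- c = 0 forces a = 0
    have ha3 : a ^ 3 ≤ 0 := by rw [← hc0] at hgood; simpa using hgood
    have ha0 : a = 0 := by
      by_contra hne
      have hapos : 0 < a := lt_of_le_of_ne ha (Ne.symm hne)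
      have := pow_pos hapos 3
      linarith
    subst ha0; rw [← hc0]; ring_nf; positivity
  · -- c > 0: complete the square, c·(expr) = (c V̄ − a² F̄)² + (2abc − a⁴) F̄²
    have key : c * (c * Vb ^ 2 - 2 * a ^ 2 * Vb * Fb + 2 * a * b * Fb ^ 2)
        = (c * Vb - a ^ 2 * Fb) ^ 2 + (2 * a * b * c - a ^ 4) * Fb ^ 2 := by ring
    have hnn : 0 ≤ c * (c * Vb ^ 2 - 2 * a ^ 2 * Vb * Fb + 2 * a * b * Fb ^ 2) := by
      rw [key]; nlinarith [sq_nonneg (c * Vb - a ^ 2 * Fb), sq_nonneg Fb, h4]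
    exact (mul_nonneg_iff_of_pos_left hcpos).mp hnn

/-! ### The forest case: (L-V*) for the largest-`b/a` boundary edge -/

/-- **Forest local inequality.**  On a forest the apex instance is `e`'s gadget plus an independent rest: `V = pq a² + p x + v`,
`EL = p a + g` with `x = b − a²` the piece variance and `(v, g)` the rest's variance and mean.  If `b g ≥ a v` (the rest's ratio
`v/g` is at most `b/a`), then the size-biased form of (L-V*) holds even without the `Δ_e` term:
`2 a² V ≤ 2 a b · EL + p q a⁴`; indeed the slack is `p a⁴ (1 + p) + 2 a (b g − a v)`. [this work] -/
theorem forest_local (p a b x v g V EL : ℝ) (hp0 : 0 ≤ p) (ha : 0 ≤ a) (hx : x = b - a ^ 2)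
    (hV : V = p * (1 - p) * a ^ 2 + p * x + v) (hEL : EL = p * a + g) (hrest : a * v ≤ b * g) :
    2 * a ^ 2 * V ≤ 2 * a * b * EL + p * (1 - p) * a ^ 4 := by
  have slack : 2 * a * b * EL + p * (1 - p) * a ^ 4 - 2 * a ^ 2 * V
      = p * a ^ 4 * (1 + p) + 2 * a * (b * g - a * v) := by
    rw [hV, hEL, hx]; ring
  nlinarith [slack, mul_nonneg (mul_nonneg hp0 (pow_nonneg ha 4)) (by linarith : (0:ℝ) ≤ 1 + p),
             mul_nonneg (mul_nonneg (by norm_num : (0:ℝ) ≤ 2) ha) (sub_nonneg.mpr hrest)]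

/-- **The rest of a forest has ratio at most the largest size-biased load.**  If every other gadget `j` has `p_j ≥ 0`
and `b_j ≤ M a_j`, then its variance `v = Σ_j (p_j b_j − p_j² a_j²)` and mean `g = Σ_j p_j a_j` satisfy `v ≤ M g`; so for the boundary
edge `e` with the largest `b/a = M` the hypothesis `a v ≤ b g` of `forest_local` holds. [this work] -/
theorem rest_le_of_mhat_le {ι : Type*} (s : Finset ι) (pj aj bj : ι → ℝ) (M : ℝ)
    (hp : ∀ j ∈ s, 0 ≤ pj j) (hb : ∀ j ∈ s, bj j ≤ M * aj j) :
    ∑ j ∈ s, (pj j * bj j - pj j ^ 2 * aj j ^ 2) ≤ M * ∑ j ∈ s, pj j * aj j := by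
  rw [Finset.mul_sum]
  refine Finset.sum_le_sum fun j hj => ?_
  have h1 : pj j * bj j ≤ pj j * (M * aj j) := mul_le_mul_of_nonneg_left (hb j hj) (hp j hj)
  nlinarith [h1, sq_nonneg (pj j * aj j)]

/-- **Forest corollary.**  Combining `rest_le_of_mhat_le` with `forest_local`: for the largest-`b/a` boundary edge of a forest
(`b = M a`, `a ≥ 0`, rest built from gadgets with `p_j ≥ 0`, `b_j ≤ M a_j`) the size-biased local inequality `2a²V ≤ 2ab·EL + pq a⁴` holds. [this work] -/
theorem forest_local_max {ι : Type*} (s : Finset ι) (pj aj bj : ι → ℝ) (M p a b x V EL : ℝ)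
    (hp : ∀ j ∈ s, 0 ≤ pj j) (hbj : ∀ j ∈ s, bj j ≤ M * aj j)
    (hp0 : 0 ≤ p) (ha : 0 ≤ a) (hbM : b = M * a) (hx : x = b - a ^ 2)
    (hV : V = p * (1 - p) * a ^ 2 + p * x + ∑ j ∈ s, (pj j * bj j - pj j ^ 2 * aj j ^ 2))
    (hEL : EL = p * a + ∑ j ∈ s, pj j * aj j) :
    2 * a ^ 2 * V ≤ 2 * a * b * EL + p * (1 - p) * a ^ 4 := by
  have hrest := rest_le_of_mhat_le s pj aj bj M hp hbj
  refine forest_local p a b x _ _ V EL hp0 ha hx hV hEL ?_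
  calc a * ∑ j ∈ s, (pj j * bj j - pj j ^ 2 * aj j ^ 2)
      ≤ a * (M * ∑ j ∈ s, pj j * aj j) := mul_le_mul_of_nonneg_left hrest ha
    _ = b * ∑ j ∈ s, pj j * aj j := by rw [hbM]; ring

end APL

end Summit.CriticalPhenomena.PercolationContinuityZ3.Theorems
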